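import Summits.BirchSwinnertonDyer.BirchSwinnertonDyer.Theorems.KolyvaginRoadThreeConductorOneData
import Summits.BirchSwinnertonDyer.BirchSwinnertonDyer.Theorems.ErratumRoadFiveKolyvaginClose
import Summits.BirchSwinnertonDyer.BirchSwinnertonDyer.Theorems.ErratumRoadFiveControlFromJSWMult
import HarnessLib

/-!
# Route `ErratumRoadFive` (rung K2a), crux `RamNoErratumDataAtFive` (item stmt-BirchSwinnertonDyer-19624,
# REST‴): the KOLYVAGIN ROAD at `p ≥ 5` in the Hoffstein–Luo ∀-frame ♯ typing — the A1/Locus kernel of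
# route `KolyvaginRoadThree` (`Koly.bsdp_three_onA1_of_kolyvaginFramesHL`, p424749) PORTED from `p = 3` to
# every `p ≥ 5`, composed with tightness (the pair-level kernel; the companion `ErratumRoadFiveKolyvaginRestTam`
# shrinks REST‴ to its Tamagawa part REST⁗ = REST‴ ∩ {p ∣ ∏ c_ℓ}) (cell `bsd-stepL`, seat `bsd-stepL-imc-p1` g5;
# `--supports stmt-BirchSwinnertonDyer-19624`; Theses-FREE imports, so a route file may import this module)

HONEST FRAMING. THEOREMS ONLY (no definition, no named fact, no `sorry`); nothing about Kolyvagin's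
conjecture or about BSD is asserted; every published ∕ cited named fact is a HYPOTHESIS; the Kolyvagin
non-vanishing statement `hZ` is a HYPOTHESIS in the exact ∀-frame ♯ shape of the KOLY route's deciding crux
`Theses.KolyvaginRoadThree.ZhangSharpFrameAtThreeHL` with `3` replaced by `p ≥ 5` (where it is Skinner–Zhang
arXiv:1407.1099 Thm. 1.3 on its ♠-locus — PREPRINT — and the cell's refereed memo THEOREM SZ14♯, MEMO-v5, on the
whole Locus; conjecture-tagged tree statement `Koly.SkinnerZhangSharp`). BSD is proved for no pair by this file;
no census number of record moves.

## Why this file (REST‴ after D4)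

After the D4 edit (K2 rev 9–12, planner g25) the erratum road's residual is the crux
`RamNoErratumDataAtFive` = REST‴ (imc-p1 g3): `P2OpenInputOnTreeAt W p` at every (ram) pair carrying NO erratum
datum — atom (α): no odd NON-split `E[p]`-ramified multiplicative `q ≠ p` (every ramified witness split, or only
`q = 2`), atom (β): `E(ℚ_p)[p] ≠ 0`. The erratum road is saturated there (Castella's erratum Thm. 1.1 (iii) ∕ (iv)).
The KOLYVAGIN road does not care about the splitting type of the auxiliary prime: at a classical Heegner field
(every `ℓ ∣ N` split in `K`) one non-zero mod-`p` Kolyvagin class + McCallum's structure theorem give STEP L and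
hence `BSD(E,p)` on the Locus `(ram) ∧ p ∤ ∏ c_ℓ` (koly g6, `ClassX11b.bsdp_of_kolyvaginClass_one_ne_zero_of_mccallum_of_five_le`),
and `BSD(E,p)` gives the open input back (tightness `P2.openInputOnTreeAt_of_bsdp_of_ram`, multr1-p2 gen 18, with
the control identity from JSW17 Thm. 3.3.1-mult, imc-t1 g5 ∕ imc-p1 g3 `p2ControlOnTreeAt_of_thm331Mult`). Atom (β)
lies inside `{p ∣ c_p}` (`LocalTorsion.split_and_dvd_of_localTorsion_ne_zero`), so on `p ∤ ∏ c_ℓ` only (α) rows occur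
and the erratum condition (iv) is automatic (`LocalTorsion.localTorsion_eq_zero_of_not_dvd_tamagawaProduct`).

## What this file proves

* §0 `exists_oddHeegnerData_discr_lt` — the route's Hoffstein–Luo datum with `d_K < −4` RETAINED (so `d_K ≠ −3`,
  the McCallum kernel's binder at `p ≥ 5`; `exists_oddHeegnerData` exports only `p ∤ #𝓞_K^×`, which at `p ≥ 5` does
  not exclude `d_K = −3`).
* §1 `Koly.bsdp_of_kolyvaginFramesHLAt_of_five_le` — the HL kernel AT A PAIR `(W, p)`, `p ≥ 5`, on the Locus: published
  facts + seam G-a (`hKD`) + McCallum + `hZ` (Kolyvagin non-vanishing at every Manin-good conductor-1 frame of every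
  Hoffstein–Luo field OF THIS PAIR) ⟹ `BSDp W p`. Proof = zhang3-p1's `bsdp_three_onA1_of_kolyvaginFramesHL` with
  `3 ↦ p` over koly's `p ≥ 5` closer (seam G-a is discharged by Darmon Thm. 3.6 in the companion's class-level forms).
* §2 `Koly.openInputOnTreeAt_of_kolyvaginFramesHLAt_of_five_le` — the same ⟹ `P2OpenInputOnTreeAt W p` given the
  control identity `P2ControlOnTreeAt W p` (supplied class-wide by the JSW fact in the companion).
* §3–§4 (REST‴ ⟸ `hZα` + REST⁗; class level on the whole Locus) are in the companion module
  `ErratumRoadFiveKolyvaginRestTam.lean`, which imports this one.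

CENSUS WORDS (class-wide cw pairs, `p ≥ 5`, `N < 5·10⁵`, multr1-p1 `census2_all_500k`; imc-p1 g3 fold): REST‴ ∩ (ram)
= 703 204 = (α) 700 633 + (β) 2 571; the Locus is 2 093 111 of the 2 155 109 (ram) pairs, so REST⁗ ⊆ (ram) ∖ Locus has
at most 61 998 cw pairs (exact fold in the seat's evidence note). CONDITIONAL on every binder; nothing booked.

References (locators only): [cite: SkinnerZhang2014, Thm. 1.3 (§1 p. 3) and §12.3 — shape of `hZ`]
[cite: WZhang2014, Thm. 1.1, Remark 5, Thm. 10.2] [cite: McCallumLMS1991, §5 Cor. 5.6 (p. 310)]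
[cite: Darmon2004, Thm. 3.6 (PDF pp. 43–44)] [cite: HoffsteinLuo1997, Theorem (§1)] [cite: JetchevSkinnerWan2017, Thm. 3.3.1, §7.4.1]
[cite: Castella2018, Thm. 2.3, Thm. 3.2] [cite: Castella2018Erratum, Thm. 1.1 (iii)–(iv), (2.4)] [cite: SilvermanATAEC1994, Cor. IV.9.2].
-/

noncomputable section

open scoped Classical

namespace Summit.BirchSwinnertonDyer.Rank1Residual.X11b

open WeierstrassCurve NumberField Literature.NumberTheory.EllipticCurves
  Literature.NumberTheory.EllipticCurves.ModularForms
  Literature.NumberTheory.EllipticCurves.Rank1Residual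

/-! ### §0 The Hoffstein–Luo datum with `d_K < −4` retained -/

/-- **The route's odd Heegner datum with `d_K < −4` kept** (`exists_oddHeegnerData`, same proof, one more
conjunct exported): for `(E, p)` with `r_an = 1`, `p` odd multiplicative, `E[p]` irreducible — an imaginary
quadratic `K` with `d_K` ODD, `d_K < −4` (hence `d_K ∉ {−3, −4}`, `#𝓞_K^× = 2`), `p ∤ d_K`, every `ℓ ∣ N` split,
`L(E^{d_K},1) ≠ 0` (Hoffstein–Luo + modularity, sign `−1`), a Manin-unit datum `(Dt, H, ι, P)` with `p ∤ c`
(Mazur), and a globally minimal model of the twist. Bookkeeping. [cite: HoffsteinLuo1997, Theorem (§1, pp. 435–436)]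
[cite: Mazur1978, Cor. 4.1] -/
theorem exists_oddHeegnerData_discr_lt (hnf : exists_isNewformOf)
    (hHL : HoffsteinLuo1997_exists_twist_L_one_ne_zero)
    (hMaz : mazur_not_dvd_maninConstant_of_odd) (hNS : integral_neronScaling_of_isGloballyMinimal)
    (W : WeierstrassCurve ℚ) [W.IsElliptic] [W.IsGloballyMinimal] (p : ℕ) [Fact p.Prime]
    [NeZero (W.conductorNorm ℤ)]
    (hr : W.analyticRank = 1) (hp2 : p ≠ 2) (hmult : Mult W p) (hirr : Irr W p) :
    ∃ (K : Type) (_ : Field K) (_ : NumberField K)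
      (Dt : ModularParametrizationData W (W.conductorNorm ℤ))
      (H : HeegnerDatum (W.conductorNorm ℤ) (NumberField.discr K)) (ι : K →+* ℂ)
      (P : (W.baseChange K).toAffine.Point)
      (Wd : WeierstrassCurve ℚ) (_ : Wd.IsElliptic) (_ : Wd.IsGloballyMinimal) (Cd : VariableChange ℚ),
      IsImaginaryQuadratic K ∧ Odd (NumberField.discr K) ∧ NumberField.discr K < -4 ∧
        ¬ (p : ℤ) ∣ NumberField.discr K ∧
        SatisfiesHeegnerHypothesis (W.conductorNorm ℤ) K ∧
        WeierstrassCurve.Affine.Point.map ι.toRatAlgHom P = heegnerPointComplex Dt H ∧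
        ¬ (p : ℤ) ∣ Dt.c ∧ ¬ p ∣ Units.torsionOrder K ∧
        (W.quadraticTwist (NumberField.discr K : ℚ)).entireLFunction 1 ≠ 0 ∧
        Cd • W.quadraticTwist (NumberField.discr K : ℚ) = Wd := by
  have hp : p.Prime := Fact.out
  have hw : W.rootNumber = -1 := by
    rw [WeierstrassCurve.rootNumber_eq_neg_one_pow_analyticRank_of_exists_isNewformOf hnf W, hr]
    norm_num
  obtain ⟨K, _, _, hK, hodd, hlt, hHN, hHp, hLt⟩ :=
    exists_admissibleField_of_rootNumber_eq_neg_one hnf hHL W hw p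
  have hpd : ¬ (p : ℤ) ∣ NumberField.discr K := not_dvd_discr_of_split hK hp hp2 hHp
  have hμ : ¬ p ∣ Units.torsionOrder K := by
    haveI : IsTotallyComplex K := hK.2
    rw [Literature.NumberTheory.DiophantineGeometry.torsionOrder_eq_two_of_discr_lt hK.1 hlt]
    intro h2
    have := Nat.le_of_dvd two_pos h2
    have := hp.two_le
    omega
  obtain ⟨Dt, H, ι, P, hP, hc⟩ :=
    exists_maninDatum_of_odd hnf hMaz hNS W p (W.conductorNorm ℤ) K rfl hp2 hmult hirr hK hHN
  have hD0 : (NumberField.discr K : ℚ) ≠ 0 := by exact_mod_cast NumberField.discr_ne_zero K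
  haveI hEt : (W.quadraticTwist (NumberField.discr K : ℚ)).IsElliptic :=
    W.isElliptic_quadraticTwist hD0
  obtain ⟨Cd, hCd⟩ := hasGlobalMinimalModel_rat_holds (W.quadraticTwist (NumberField.discr K : ℚ))
  exact ⟨K, inferInstance, inferInstance, Dt, H, ι, P, Cd • W.quadraticTwist (NumberField.discr K : ℚ),
    inferInstance, hCd, Cd, hK, hodd, hlt, hpd, hHN, hP, hc, hμ, hLt, rfl⟩

end Summit.BirchSwinnertonDyer.Rank1Residual.X11b

namespace Summit.BirchSwinnertonDyer.Rank1Residual.X11b.Three.Koly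

open WeierstrassCurve Literature.NumberTheory.EllipticCurves
  Literature.NumberTheory.EllipticCurves.ModularForms
  Literature.NumberTheory.EllipticCurves.Rank1Residual
  Summit.BirchSwinnertonDyer.Rank1Residual Summit.BirchSwinnertonDyer.Rank1Residual.X11b

/-! ### §1 The HL kernel at a pair, `p ≥ 5` -/

/-- **The Kolyvagin road's HL kernel AT A PAIR `(E, p)`, `p ≥ 5`, on the Locus** (the `p ≥ 5` twin of
`Koly.bsdp_three_onA1_of_kolyvaginFramesHL`): for `(E, p)` in class X11b (`r_an = 1`, `p ∥ N`, `E[p]` irreducible)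
with `p ≥ 5`, a (ram) witness and `p ∤ ∏ c_ℓ`: under the published named facts (Gross–Zagier, Kolyvagin ×2,
Skinner 2016 Thm C, GZK, modularity, newforms, Hoffstein–Luo, Mazur's Manin constant, Shimura reciprocity at
conductor 1), the seam `hKD` (conductor-1 Kolyvagin–Heegner data on every admissible frame), McCallum's structure
theorem `hMc`, and `hZ` — Kolyvagin's conjecture mod `p` at every Manin-good conductor-1 frame `(Dt, β, ι)` of every
Hoffstein–Luo field of THIS pair (`K` imaginary quadratic, `d_K` odd, Heegner for `N_E`, `L(E^{d_K},1) ≠ 0`,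
`d_K ≠ −3`; HYPOTHESIS) — `BSDp W p`. Proof: one Hoffstein–Luo datum (`exists_oddHeegnerData_discr_lt`), its
conductor-1 datum (`hKD`) descending to the Heegner point (`hrec`), `y_K` non-torsion (Gross–Zagier), `E(K)` of
rank one with `Ш(E/K)` finite (Kolyvagin), `E(K)[p] = 0` (irreducibility), `p^{M₀} ∥ y_K` (Mordell–Weil), then
`hZ` at this frame and koly's closer `ClassX11b.bsdp_of_kolyvaginClass_one_ne_zero_of_mccallum_of_five_le`.
CONDITIONAL on every binder; nothing booked. [cite: WZhang2014, Thm. 1.1, Remark 5 and Thm. 10.2]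
[cite: SkinnerZhang2014, Thm. 1.3 and §12.3 (shape of `hZ`)] [cite: McCallumLMS1991, §5 Cor. 5.6 (p. 310)]
[cite: HoffsteinLuo1997, Theorem (§1)] -/
theorem bsdp_of_kolyvaginFramesHLAt_of_five_le
    -- published named facts
    (hGZ : ∀ (N : ℕ) [NeZero N] (W : WeierstrassCurve ℚ) (K : Type) [Field K] [NumberField K],
      gross_zagier N W K)
    (hKo : ∀ (N : ℕ) [NeZero N] (W : WeierstrassCurve ℚ) (K : Type) [Field K] [NumberField K],
      kolyvagin N W K)
    (hB : ∀ (N : ℕ) [NeZero N] (W : WeierstrassCurve ℚ) (K : Type) [Field K] [NumberField K],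
      Kolyvagin1990_padicValNat_card_sha_le N W K)
    (hSk : Skinner2016.thmC_padicValRat_bsd_rank_zero)
    (hGZK : rank_eq_analyticRank_of_analyticRank_le_one) (hmod : hasEntireLFunction_rat)
    (hnf : exists_isNewformOf) (hHL : HoffsteinLuo1997_exists_twist_L_one_ne_zero)
    (hMaz : mazur_not_dvd_maninConstant_of_odd)
    (hrec : ∀ (N : ℕ) [NeZero N] (W : WeierstrassCurve ℚ) (K : Type) [Field K] [NumberField K],
      heegnerPointOfConductor_one_galoisConj N W K)
    (hMc : McCallum1991_pow_dvd_card_sha_primary_of_certificate)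
    -- SEAM G-a: conductor-1 Kolyvagin–Heegner data exist on every admissible frame (hypothesis shape)
    (hKD : ∀ (W : WeierstrassCurve ℚ) [W.IsElliptic] [W.IsGloballyMinimal] [NeZero (W.conductorNorm ℤ)]
      (K : Type) [Field K] [NumberField K]
      (Dt : ModularParametrizationData W (W.conductorNorm ℤ)) (β : ℤ) (ι : K →+* ℂ),
      IsImaginaryQuadratic K → SatisfiesHeegnerHypothesis (W.conductorNorm ℤ) K →
      (4 * (W.conductorNorm ℤ : ℤ)) ∣ β ^ 2 - NumberField.discr K →
      Nonempty (KolyvaginHeegnerData Dt β ι 1))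
    -- the pair: on the Locus, p ≥ 5
    (W : WeierstrassCurve ℚ) [W.IsElliptic] [W.IsGloballyMinimal] [NeZero (W.conductorNorm ℤ)]
    (p : ℕ) [hp : Fact p.Prime]
    (hX : ClassX11b W p) (hp5 : 5 ≤ p) (hram : Ram W p) (htam : ¬ p ∣ W.tamagawaProduct)
    -- Kolyvagin's conjecture mod p at every Manin-good conductor-1 frame of every Hoffstein–Luo field OF THIS PAIR
    (hZ : ∀ (K : Type) [Field K] [NumberField K]
      (Dt : ModularParametrizationData W (W.conductorNorm ℤ)) (β : ℤ) (ι : K →+* ℂ),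
      IsImaginaryQuadratic K → Odd (NumberField.discr K) →
      SatisfiesHeegnerHypothesis (W.conductorNorm ℤ) K →
      (W.quadraticTwist (NumberField.discr K : ℚ)).entireLFunction 1 ≠ 0 →
      NumberField.discr K ≠ -3 →
      (4 * (W.conductorNorm ℤ : ℤ)) ∣ β ^ 2 - NumberField.discr K → ¬ (p : ℤ) ∣ Dt.c →
      ∃ (n : ℕ) (d : KolyvaginHeegnerData Dt β ι n),
        KolyvaginDescent.KolSupp (Zhang2014.IsKolyvaginPrime (W.conductorNorm ℤ) W K p) n ∧
          d.kolyvaginClass hp.out 1 ≠ 0) :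
    BSDp W p := by
  have hmult : W.HasMultiplicativeReductionAtPrime p := hX.2.2.1
  have hirr : Irr W p := hX.2.2.2
  have hp2 : p ≠ 2 := by omega
  -- ONE odd Heegner datum with a Manin-good frame (Hoffstein–Luo field with d_K < -4; Mazur; w_K = 2)
  obtain ⟨K, _, _, Dt, H, ι, P, Wd, _, _, Cd, hK, hodd, hlt, -, hHN, hP, hc, hμ, hLt, hWd⟩ :=
    exists_oddHeegnerData_discr_lt hnf hHL hMaz integral_neronScaling_of_isGloballyMinimal_holds W p hX.1
      hp2 hmult hirr
  have h3 : NumberField.discr K ≠ -3 := by omega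
  -- seam G-a: a conductor-1 Kolyvagin–Heegner datum on the frame (Dt, H.β, ι)
  obtain ⟨d₁⟩ := hKD W K Dt H.β ι hK hHN H.dvd_sq_sub
  -- the bottom point: P(1) = y_K = P in E(K̄) (Shimura reciprocity at conductor 1, named fact `hrec`)
  have hPd : d₁.toGeomPoints d₁.derivedPoint = toGeomPoints (W.baseChange K) P :=
    KolyvaginBottom.toGeomPoints_derivedPoint_one_eq (hrec _ W K) hK hHN hP d₁ rfl
  -- y_K is non-torsion (Gross–Zagier at r_an = 1 with L(E^{d_K},1) ≠ 0); rank one, Ш finite (Kolyvagin)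
  have hPinf : ¬ IsOfFinAddOrder P :=
    not_isOfFinAddOrder_of_heegner_of_analyticRank_eq_one W (W.conductorNorm ℤ) K Dt H ι P (hGZ _ W K) hmod
      hX.1 hK hHN hLt hP
  obtain ⟨hrank, hSha⟩ := hKo (W.conductorNorm ℤ) W K hK hHN ⟨Dt, H, ι, hP⟩ hPinf
  haveI : Finite (W.baseChange K).sha := hSha
  -- E(K)[p] = 0 (E[p] irreducible, K imaginary quadratic)
  have hbot := torsionBy_eq_bot_of_isImaginaryQuadratic_of_hasIrreducibleModPGaloisRep W K hK hp.out hirr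
  have hiv : ∀ x : (W.baseChange K).toAffine.Point, p • x = 0 → x = 0 := fun x hx ↦ by
    have hmem : x ∈ AddSubgroup.torsionBy (W.baseChange K).toAffine.Point ((p : ℕ) : ℤ) := by
      rw [mem_torsionBy_iff, natCast_zsmul]
      exact hx
    rw [hbot] at hmem
    exact hmem
  -- the exponent p^{M₀} ∥ y_K (Mordell–Weil)
  haveI : Module.Finite ℤ (W.baseChange K).toAffine.Point := (W.baseChange K).module_finite_point_holds
  obtain ⟨M₀, x₀, hx₀, hmax⟩ := exists_pow_smul_eq_and_forall_ne hPinf (p := p) hp.out.two_le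
  have hdiv : ∃ Q : (W.baseChange K).toAffine.Point, ((p ^ M₀ : ℕ) : ℤ) • Q = P :=
    ⟨x₀, by rw [natCast_zsmul]; exact hx₀⟩
  have hndiv : ¬ ∃ Q : (W.baseChange K).toAffine.Point, ((p ^ (M₀ + 1) : ℕ) : ℤ) • Q = P := by
    rintro ⟨Q, hQ⟩
    exact hmax Q (by rw [← natCast_zsmul]; exact hQ)
  -- Kolyvagin's conjecture mod p at this Manin-good frame of THIS Hoffstein–Luo pair
  obtain ⟨n, d, hn, hne⟩ := hZ K Dt H.β ι hK hodd hHN hLt h3 H.dvd_sq_sub hc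
  -- the end-to-end theorem at this datum (koly g6, p ≥ 5)
  exact ClassX11b.bsdp_of_kolyvaginClass_one_ne_zero_of_mccallum_of_five_le W p K Dt H ι P (hGZ _ W K)
    (hKo _ W K) (hB _ W K) hSk hGZK hmod hX hp5 hram htam hK hodd h3 hHN hP hc hμ hLt Wd Cd hWd H.β d₁ hPd
    hPinf hrank hiv hdiv hndiv d hn hne hMc

/-! ### §2 The open input of route p2 at a Locus pair from the Kolyvagin road -/

/-- **The Kolyvagin road gives route p2's OPEN INPUT at a Locus pair, `p ≥ 5`**: the hypotheses of
`bsdp_of_kolyvaginFramesHLAt_of_five_le` plus the control identity `P2ControlOnTreeAt W p` (Cas18 Thm. 2.3 ∕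
JSW17 Thm. 3.3.1, PUB shape) ⟹ `P2OpenInputOnTreeAt W p` — `BSD(E,p)` by §1, then tightness
(`P2.openInputOnTreeAt_of_bsdp_of_ram`, multr1-p2 gen 18: `BSD(E,p)` gives STEP L back at every odd Manin-good
datum, and the control identity converts STEP L into the (IMC ≥ ∘ BDP) inequality). CONDITIONAL on every binder;
nothing booked. [cite: Castella2018, Thm. 2.3 (p. 5), Thm. 3.2 (p. 9)] [cite: JetchevSkinnerWan2017, §7.4.1 (pp. 30–31)]
[cite: McCallumLMS1991, §5 Cor. 5.6 (p. 310)] -/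
theorem openInputOnTreeAt_of_kolyvaginFramesHLAt_of_five_le
    (hGZ : ∀ (N : ℕ) [NeZero N] (W : WeierstrassCurve ℚ) (K : Type) [Field K] [NumberField K],
      gross_zagier N W K)
    (hKo : ∀ (N : ℕ) [NeZero N] (W : WeierstrassCurve ℚ) (K : Type) [Field K] [NumberField K],
      kolyvagin N W K)
    (hB : ∀ (N : ℕ) [NeZero N] (W : WeierstrassCurve ℚ) (K : Type) [Field K] [NumberField K],
      Kolyvagin1990_padicValNat_card_sha_le N W K)
    (hSk : Skinner2016.thmC_padicValRat_bsd_rank_zero)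
    (hGZK : rank_eq_analyticRank_of_analyticRank_le_one) (hmod : hasEntireLFunction_rat)
    (hnf : exists_isNewformOf) (hHL : HoffsteinLuo1997_exists_twist_L_one_ne_zero)
    (hMaz : mazur_not_dvd_maninConstant_of_odd)
    (hrec : ∀ (N : ℕ) [NeZero N] (W : WeierstrassCurve ℚ) (K : Type) [Field K] [NumberField K],
      heegnerPointOfConductor_one_galoisConj N W K)
    (hMc : McCallum1991_pow_dvd_card_sha_primary_of_certificate)
    (hKD : ∀ (W : WeierstrassCurve ℚ) [W.IsElliptic] [W.IsGloballyMinimal] [NeZero (W.conductorNorm ℤ)]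
      (K : Type) [Field K] [NumberField K]
      (Dt : ModularParametrizationData W (W.conductorNorm ℤ)) (β : ℤ) (ι : K →+* ℂ),
      IsImaginaryQuadratic K → SatisfiesHeegnerHypothesis (W.conductorNorm ℤ) K →
      (4 * (W.conductorNorm ℤ : ℤ)) ∣ β ^ 2 - NumberField.discr K →
      Nonempty (KolyvaginHeegnerData Dt β ι 1))
    (W : WeierstrassCurve ℚ) [W.IsElliptic] [W.IsGloballyMinimal] [NeZero (W.conductorNorm ℤ)]
    (p : ℕ) [hp : Fact p.Prime]
    (hX : ClassX11b W p) (hp5 : 5 ≤ p) (hram : Ram W p) (htam : ¬ p ∣ W.tamagawaProduct)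
    -- the control IDENTITY at the pair (PUB shape)
    (hC : P2ControlOnTreeAt W p)
    (hZ : ∀ (K : Type) [Field K] [NumberField K]
      (Dt : ModularParametrizationData W (W.conductorNorm ℤ)) (β : ℤ) (ι : K →+* ℂ),
      IsImaginaryQuadratic K → Odd (NumberField.discr K) →
      SatisfiesHeegnerHypothesis (W.conductorNorm ℤ) K →
      (W.quadraticTwist (NumberField.discr K : ℚ)).entireLFunction 1 ≠ 0 →
      NumberField.discr K ≠ -3 →
      (4 * (W.conductorNorm ℤ : ℤ)) ∣ β ^ 2 - NumberField.discr K → ¬ (p : ℤ) ∣ Dt.c →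
      ∃ (n : ℕ) (d : KolyvaginHeegnerData Dt β ι n),
        KolyvaginDescent.KolSupp (Zhang2014.IsKolyvaginPrime (W.conductorNorm ℤ) W K p) n ∧
          d.kolyvaginClass hp.out 1 ≠ 0) :
    P2OpenInputOnTreeAt W p :=
  P2.openInputOnTreeAt_of_bsdp_of_ram W p hGZ hKo hSk hGZK hmod hC hram
    (bsdp_of_kolyvaginFramesHLAt_of_five_le hGZ hKo hB hSk hGZK hmod hnf hHL hMaz hrec hMc hKD W p hX hp5 hram
      htam hZ)

end Summit.BirchSwinnertonDyer.Rank1Residual.X11b.Three.Koly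

end
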